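import Summits.QuantumFields.YangMills.Theorems.StaticSourceWitnessRungGaussianMoments

/-!
# Route `StaticSourceWitness`, crux X₁ `StaticSourceResponse` (stmt-QuantumFields-25284):
# lattice-Maxwell rung, file 2/5 — the static-source identity (★) for ANY centred Gaussian pair

Banking file (`--supports stmt-QuantumFields-25284`), port of Part A.4 of the crux workfile
`Cruxes/StaticSourceResponse/Lines/rung.lean` v3 (seat `ym-mirror-bc5w-1`, 2026-08-28).

For a pair of real random variables `(U, V)` with centred jointly Gaussian law on any probability
space, the law of `(U, V)` is the image of `μ2 = γ ⊗ γ` under the Cholesky map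
`cholT s p q (ξ) = (s ξ₁, p ξ₁ + q ξ₂)` with `s² = Var U`, `sp = Cov(U,V)`, `p² + q² = Var V`
(`chol_exists` = the covariance Cauchy–Schwarz inequality in Cholesky form; `gaussianPair_law_eq`,
via Mathlib's `IsGaussian.ext_covarianceBilinDual`: a Gaussian measure is determined by its mean and
covariance form).  Hence (★) of file 1/5 holds for `(U, V)`:

  `Cov(cos U, V²) = −E[cos U]·Cov(U,V)²`,  `E[cos U] = e^{−Var U/2}`   (`gaussianPair_staticSource_identity`),

and the ratio floor `c₁ ≤ Cov(U,V)² ⇒ 0 < E[cos U] ∧ c₁·E[cos U] ≤ |Cov(cos U, V²)|`, uniformly in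
`Var U` (`gaussianPair_staticSource_floor`).  File 3/5 applies this to the lattice Maxwell field.

NOTHING here proves the Yang–Mills mass gap, `BalabanLadder.NT`, or X₁.
-/

set_option autoImplicit false

open MeasureTheory ProbabilityTheory Complex
open scoped Real NNReal ENNReal

noncomputable section

namespace Summit.QuantumFields.YangMills.Theorems.StaticSourceWitness.Rung

section GaussianPair

variable {Ω : Type*} [MeasurableSpace Ω] {P : Measure Ω} {U V : Ω → ℝ}

/-- `cholT s p q (ξ₁, ξ₂) = (s ξ₁, p ξ₁ + q ξ₂)`. [folklore] -/
@[simp] theorem cholT_apply (s p q : ℝ) (ξ : ℝ × ℝ) :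
    cholT s p q ξ = (s * ξ.1, p * ξ.1 + q * ξ.2) := by
  simp [cholT]

/-- A linear functional on `ℝ × ℝ` in coordinates: `L x = L(1,0) x₁ + L(0,1) x₂`. [folklore] -/
theorem dual_apply_eq (L : StrongDual ℝ (ℝ × ℝ)) (x : ℝ × ℝ) :
    L x = L (1, 0) * x.1 + L (0, 1) * x.2 := by
  have hx : x = x.1 • ((1 : ℝ), (0 : ℝ)) + x.2 • ((0 : ℝ), (1 : ℝ)) := by ext <;> simp
  conv_lhs => rw [hx]
  rw [map_add, map_smul, map_smul, smul_eq_mul, smul_eq_mul]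
  ring

/-- `γ` has a second moment (lambda form). [folklore] -/
theorem memLp_two_γ' : MemLp (fun x : ℝ => x) 2 γ := memLp_id_gaussianReal' 2 (by simp)

/-- `Var_{γ⊗γ}(α ξ₁ + β ξ₂) = α² + β²`. [folklore] -/
theorem variance_linear_μ2 (α β : ℝ) :
    Var[fun ξ : ℝ × ℝ => α * ξ.1 + β * ξ.2; μ2] = α ^ 2 + β ^ 2 := by
  have h : Var[fun ξ : ℝ × ℝ => α * ξ.1 + β * ξ.2; μ2]
      = Var[fun x : ℝ => α * x; γ] + Var[fun y : ℝ => β * y; γ] :=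
    variance_add_prod (memLp_two_γ'.const_mul α) (memLp_two_γ'.const_mul β)
  rw [h, variance_const_mul, variance_const_mul, variance_fun_id_gaussianReal]
  simp

/-- `γ ⊗ γ` is a Gaussian measure on `ℝ × ℝ` (used as a local instance inside proofs). [folklore] -/
theorem isGaussian_μ2 : IsGaussian μ2 := by
  unfold μ2 γ; infer_instance

/-- `γ ⊗ γ` is centred. [folklore] -/
theorem integral_μ2_id : ∫ ξ, ξ ∂μ2 = 0 := by
  haveI := isGaussian_μ2
  have hid : Integrable (fun ξ : ℝ × ℝ => ξ) μ2 :=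
    (IsGaussian.memLp_two_id (μ := μ2)).integrable (by norm_num)
  have e : (fun ξ : ℝ × ℝ => ξ) = fun ξ => (ξ.1, ξ.2) := by funext ξ; simp
  rw [e, integral_pair hid.fst hid.snd, integral_fun_fst (fun x : ℝ => x),
    integral_fun_snd (fun y : ℝ => y)]
  simp [integral_id_gaussianReal]

/-- The covariance Cauchy–Schwarz inequality in Cholesky form: canonical coordinates `s, p, q` with
`s² = Var U`, `sp = Cov(U,V)`, `p² + q² = Var V` exist for every Gaussian pair. [folklore] -/
theorem chol_exists (hUV : HasGaussianLaw (fun ω => (U ω, V ω)) P) :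
    ∃ s p q : ℝ, s ^ 2 = Var[U; P] ∧ s * p = cov[U, V; P] ∧ p ^ 2 + q ^ 2 = Var[V; P] := by
  have := hUV.isProbabilityMeasure
  have hUm : MemLp U 2 P := hUV.fst.memLp_two
  have hVm : MemLp V 2 P := hUV.snd.memLp_two
  have hA0 : 0 ≤ Var[U; P] := variance_nonneg _ _
  have hC0 : 0 ≤ Var[V; P] := variance_nonneg _ _
  have hquad : ∀ t : ℝ, 0 ≤ t ^ 2 * Var[U; P] + 2 * (t * cov[U, V; P]) + Var[V; P] := by
    intro t
    have h := variance_nonneg (fun ω => t * U ω + V ω) P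
    rwa [variance_fun_add (hUm.const_mul t) hVm, variance_const_mul, covariance_const_mul_left] at h
  by_cases hApos : 0 < Var[U; P]
  · have hne : Real.sqrt (Var[U; P]) ≠ 0 := (Real.sqrt_pos.2 hApos).ne'
    have hCB : cov[U, V; P] ^ 2 / Var[U; P] ≤ Var[V; P] := by
      have h := hquad (-cov[U, V; P] / Var[U; P])
      have e : (-cov[U, V; P] / Var[U; P]) ^ 2 * Var[U; P]
          + 2 * (-cov[U, V; P] / Var[U; P] * cov[U, V; P]) + Var[V; P]
          = Var[V; P] - cov[U, V; P] ^ 2 / Var[U; P] := by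
        field_simp
        ring
      rw [e] at h
      linarith
    refine ⟨Real.sqrt (Var[U; P]), cov[U, V; P] / Real.sqrt (Var[U; P]),
      Real.sqrt (Var[V; P] - cov[U, V; P] ^ 2 / Var[U; P]), Real.sq_sqrt hA0, ?_, ?_⟩
    · field_simp
    · rw [div_pow, Real.sq_sqrt hA0, Real.sq_sqrt (by linarith)]
      ring
  · have hA : Var[U; P] = 0 := le_antisymm (not_lt.1 hApos) hA0
    have hB : cov[U, V; P] = 0 := by
      by_contra hB
      have h := hquad (-(Var[V; P] + 1) / (2 * cov[U, V; P]))
      rw [hA, mul_zero, zero_add] at h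
      have e : 2 * (-(Var[V; P] + 1) / (2 * cov[U, V; P]) * cov[U, V; P]) = -(Var[V; P] + 1) := by
        field_simp
      rw [e] at h
      linarith
    refine ⟨0, 0, Real.sqrt (Var[V; P]), ?_, ?_, ?_⟩
    · rw [hA]; ring
    · rw [hB]; ring
    · rw [Real.sq_sqrt hC0]; ring

/-- **Canonical coordinates**: the law of a centred Gaussian pair is `(γ ⊗ γ) ∘ cholT_{s,p,q}⁻¹`
(a Gaussian measure is determined by its mean and covariance form). [folklore] -/
theorem gaussianPair_law_eq (hUV : HasGaussianLaw (fun ω => (U ω, V ω)) P)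
    (hU0 : ∫ ω, U ω ∂P = 0) (hV0 : ∫ ω, V ω ∂P = 0) {s p q : ℝ}
    (hs : s ^ 2 = Var[U; P]) (hsp : s * p = cov[U, V; P]) (hpq : p ^ 2 + q ^ 2 = Var[V; P]) :
    P.map (fun ω => (U ω, V ω)) = μ2.map (cholT s p q) := by
  haveI := isGaussian_μ2
  have := hUV.isProbabilityMeasure
  have hG : IsGaussian (P.map fun ω => (U ω, V ω)) := hUV.isGaussian_map
  have hUm : MemLp U 2 P := hUV.fst.memLp_two
  have hVm : MemLp V 2 P := hUV.snd.memLp_two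
  have hid : Integrable (fun ξ : ℝ × ℝ => ξ) μ2 :=
    (IsGaussian.memLp_two_id (μ := μ2)).integrable (by norm_num)
  refine IsGaussian.ext_covarianceBilinDual ?_ ?_
  · rw [integral_map hUV.aemeasurable aestronglyMeasurable_id,
      integral_map (by fun_prop) aestronglyMeasurable_id]
    simp only [id]
    rw [integral_pair (hUm.integrable (by norm_num)) (hVm.integrable (by norm_num)), hU0, hV0,
      ContinuousLinearMap.integral_comp_comm _ hid, integral_μ2_id, map_zero, Prod.mk_zero_zero]
  · rw [← ContinuousLinearMap.toBilinForm_inj]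
    refine LinearMap.BilinForm.ext_of_isSymm isPosSemidef_covarianceBilinDual.isSymm
      isPosSemidef_covarianceBilinDual.isSymm fun L => ?_
    simp only [ContinuousLinearMap.toBilinForm_apply]
    rw [covarianceBilinDual_self_eq_variance IsGaussian.memLp_two_id,
      covarianceBilinDual_self_eq_variance IsGaussian.memLp_two_id,
      variance_map (by fun_prop) hUV.aemeasurable, variance_map (by fun_prop) (by fun_prop)]
    have e1 : (L : ℝ × ℝ → ℝ) ∘ (fun ω => (U ω, V ω))
        = fun ω => L (1, 0) * U ω + L (0, 1) * V ω := by
      funext ω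
      simp only [Function.comp_apply]
      rw [dual_apply_eq]
    have e2 : (L : ℝ × ℝ → ℝ) ∘ (cholT s p q)
        = fun ξ => (L (1, 0) * s + L (0, 1) * p) * ξ.1 + (L (0, 1) * q) * ξ.2 := by
      funext ξ
      simp only [Function.comp_apply, cholT_apply]
      rw [dual_apply_eq]
      ring
    rw [e1, e2, variance_linear_μ2, variance_fun_add (hUm.const_mul _) (hVm.const_mul _),
      variance_const_mul, variance_const_mul, covariance_const_mul_left,
      covariance_const_mul_right, ← hs, ← hsp, ← hpq]
    ring

/-- Transport of expectations of continuous functions of `(U, V)` to the canonical coordinates.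
[folklore] -/
theorem gaussianPair_transport (hUV : HasGaussianLaw (fun ω => (U ω, V ω)) P) {s p q : ℝ}
    (hlaw : P.map (fun ω => (U ω, V ω)) = μ2.map (cholT s p q)) (f : ℝ × ℝ → ℝ)
    (hf : Continuous f) :
    ∫ ω, f (U ω, V ω) ∂P = ∫ ξ, f (s * ξ.1, p * ξ.1 + q * ξ.2) ∂μ2 := by
  have h1 := integral_map (φ := fun ω => (U ω, V ω)) hUV.aemeasurable
    (hf.aestronglyMeasurable (μ := P.map fun ω => (U ω, V ω)))
  have h2 := integral_map (φ := cholT s p q) (μ := μ2) (by fun_prop)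
    (hf.aestronglyMeasurable (μ := μ2.map (cholT s p q)))
  rw [← h1, hlaw, h2]
  simp only [cholT_apply]

/-- **(★) for ANY centred Gaussian pair** on a probability space:
`Cov(cos U, V²) = −E[cos U]·Cov(U,V)²` and `E[cos U] = e^{−Var U/2}`. [folklore] -/
theorem gaussianPair_staticSource_identity (hUV : HasGaussianLaw (fun ω => (U ω, V ω)) P)
    (hU0 : ∫ ω, U ω ∂P = 0) (hV0 : ∫ ω, V ω ∂P = 0) :
    (∫ ω, Real.cos (U ω) * V ω ^ 2 ∂P) - (∫ ω, Real.cos (U ω) ∂P) * (∫ ω, V ω ^ 2 ∂P)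
        = -((∫ ω, Real.cos (U ω) ∂P) * cov[U, V; P] ^ 2) ∧
      ∫ ω, Real.cos (U ω) ∂P = Real.exp (-(Var[U; P] / 2)) := by
  obtain ⟨s, p, q, hs, hsp, hpq⟩ := chol_exists hUV
  have hlaw := gaussianPair_law_eq hUV hU0 hV0 hs hsp hpq
  have E1 : ∫ ω, Real.cos (U ω) * V ω ^ 2 ∂P
      = ∫ ξ, Real.cos (s * ξ.1) * (p * ξ.1 + q * ξ.2) ^ 2 ∂μ2 :=
    gaussianPair_transport hUV hlaw (fun x => Real.cos x.1 * x.2 ^ 2) (by fun_prop)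
  have E2 : ∫ ω, Real.cos (U ω) ∂P = ∫ ξ, Real.cos (s * ξ.1) ∂μ2 :=
    gaussianPair_transport hUV hlaw (fun x => Real.cos x.1) (by fun_prop)
  have E3 : ∫ ω, V ω ^ 2 ∂P = ∫ ξ, (p * ξ.1 + q * ξ.2) ^ 2 ∂μ2 :=
    gaussianPair_transport hUV hlaw (fun x => x.2 ^ 2) (by fun_prop)
  refine ⟨?_, ?_⟩
  · rw [E1, E2, E3, integral_cos_mul_Y2, integral_cosΦ, integral_Y2, ← hsp]
    ring
  · rw [E2, integral_cosΦ, ← hs]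

/-- **The ratio floor for ANY centred Gaussian pair**: a floor on the linear response
`c₁ ≤ Cov(U,V)²` certifies `0 < E[cos U] ∧ c₁·E[cos U] ≤ |Cov(cos U, V²)|`, uniformly in `Var U`
(X₁'s witness clause in every free abelian model). -/
theorem gaussianPair_staticSource_floor (hUV : HasGaussianLaw (fun ω => (U ω, V ω)) P)
    (hU0 : ∫ ω, U ω ∂P = 0) (hV0 : ∫ ω, V ω ∂P = 0) {c₁ : ℝ} (hc : c₁ ≤ cov[U, V; P] ^ 2) :
    0 < ∫ ω, Real.cos (U ω) ∂P ∧
    c₁ * ∫ ω, Real.cos (U ω) ∂P ≤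
      |(∫ ω, Real.cos (U ω) * V ω ^ 2 ∂P) - (∫ ω, Real.cos (U ω) ∂P) * (∫ ω, V ω ^ 2 ∂P)| := by
  obtain ⟨hid, hcos⟩ := gaussianPair_staticSource_identity hUV hU0 hV0
  have hpos : 0 < ∫ ω, Real.cos (U ω) ∂P := by rw [hcos]; exact Real.exp_pos _
  refine ⟨hpos, ?_⟩
  rw [hid, abs_neg, abs_of_nonneg (mul_nonneg hpos.le (sq_nonneg _)), mul_comm]
  exact mul_le_mul_of_nonneg_left hc hpos.le

end GaussianPair

end Summit.QuantumFields.YangMills.Theorems.StaticSourceWitness.Rung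

end
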